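import Summits.HodgeConjecture.HodgeConjecture.Theorems.Ring2BindersAbelianSchemeVHCLocal
import Literature.AlgebraicGeometry.Resolution.EtaleNeighbourhoodSection
import Literature.AlgebraicGeometry.Morphisms.IrreducibleAffineNeighbourhood
import Literature.AlgebraicGeometry.FundamentalGroup.RiemannExistenceEtaleLocalHomeomorph
import Literature.AlgebraicGeometry.HodgeTheory.DivisorClassesFiniteEtaleBaseChange
import HarnessLib

/-!
# Ring 2 — binder seat b02 (Hodge ladder stage 3): row b02 `AbelianSchemeVHC` IS ITS RESTRICTION TO ABELIAN SCHEMES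
# (families WITH A SECTION) over smooth irreducible affine bases — étale localisation on the base

HONEST FRAMING: research route conditional on HC_CM; not a corollary; Q11.4-sentence-2 already refuted in dim ≥ 3.

Cell `pub-hodge-ring2`, Hodge ladder stage 3, binder seat `ring2-b02`, row b02 of `BINDER-OWNERS.md` (the named
hypothesis `Ring2.Hypotheses.AbelianSchemeVHC`, `Theorems/Ring2Hypotheses.lean`:140 — Grothendieck's variational
Hodge conjecture in global-class form along smooth projective families ALL OF WHOSE COMPLEX FIBRES ARE ABELIAN
VARIETIES, over all smooth irreducible bases; OPEN, print-equivalent to `HC_AV`, nothing to discharge). `HC_CM` is not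
mentioned in any statement below; nothing here is a case of the Hodge conjecture; no definition, no named fact, no
`sorry`; nothing is discharged and no number of `BINDER-OWNERS.md` moves.

The tree types row b02 SECTION-FREE (`Motives.IsSmoothProjectiveFamily`: smooth of relative dimension `n`, proper,
smooth projective fibres; each complex fibre isomorphic to the variety underlying SOME abelian variety — no zero
section, no group law), whereas the printed carriers of every engine and of Raynaud's projectivity theorem are
ABELIAN SCHEMES. This file closes that gap unconditionally and sharpens the junction
`Theorems/Ring2BindersAbelianSchemeVHCLocal.lean` (p230163) accordingly:

* (S1) `abelianSchemeVHC_of_section`, (S1′) `abelianSchemeVHC_iff_section` — **row b02 IS its own restriction to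
  abelian-fibred families over smooth irreducible AFFINE bases WHICH ADMIT A SECTION `e : S ⟶ 𝒳`, `e ≫ f = 𝟙`**
  (hence to abelian schemes in the sense of Mumford / Laurent–Schröer: a section makes such a family an abelian scheme,
  [cite: MumfordGIT, Thm. 6.14] for projective `f`, [cite: LaurentSchroer2023, Prop. 4.3] for proper `f`).
  Engine, all tree theorems: through any closed point of the total space a SMOOTH morphism acquires a section over an
  ÉTALE neighbourhood of the base point (`Resolution.exists_etale_nhd_section`, EGA IV₄ 17.16.3); an étale
  `ℂ`-scheme over a smooth one is smooth, so the neighbourhood shrinks to an affine IRREDUCIBLE one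
  (`Morphisms.exists_opens_isAffine_irreducibleSpace_smooth`); the image of `g(ℂ)` for `g` étale is open in the
  analytic topology (`FundamentalGroup.isOpenMap_map_of_etale`, SGA 1 XII 3.1 (iii)); the data, the anchor and the
  conclusion of row b02 move across the base change `Motives.familyPullback` (`Theorems.map_fiberι_familyPullback_mem_algebraicClasses_iff`);
  and `S(ℂ)` is connected for `S` irreducible (`connectedSpace_complexPoints_of_irreducibleSpace`, SGA 1 XII 2.4), so
  the algebraicity locus of the class, being open and closed, is everything (`forall_complexPoints_of_etaleNhds`).
* (S2) `abelianSchemeVHC_of_germ_of_abelianSectionQuasiProjective`, (S2′) `…_iff_…`, (S3)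
  `abelianSchemeVHC_of_variationalHodgeQP_of_abelianSectionQuasiProjective` (+ flat-section form) — the edges (L2′),
  (L2″), (L3) of the junction file with their residual `AbelianTotalQuasiProjective[]` (quasi-projectivity of the total
  space of a SECTION-FREE abelian-fibred family over a smooth irreducible affine base) REPLACED by the weaker
  `AbelianSectionQuasiProjective[]` — the same sentence for families WITH A SECTION — which is where print lives:
  a section makes the family an abelian scheme [cite: LaurentSchroer2023, Prop. 4.3 (and its proof: MFK Prop. 6.15 at
  the closed points + EGA III 5.4.1)], an abelian scheme over a normal noetherian base is projective over it
  [cite: GortzWedhorn2023, Thm. 27.291] (after [cite: Raynaud1970, Ch. XI]), and a scheme projective over an affine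
  `ℂ`-scheme of finite type is quasi-projective over `ℂ`. `abelianSectionQuasiProjective_of_abelianTotalQuasiProjective`
  records that the new residual is implied by the old one.

THE RESIDUALS, print status (both are local notations displayed as hypotheses, NEVER asserted). Section-free
`AbelianTotalQuasiProjective[]`: a section-free smooth proper family of abelian varieties is a torsor under an abelian
scheme [cite: LaurentSchroer2023, Thm. 5.3], and over a REGULAR base such a torsor has finite order
[cite: Raynaud1970, Ch. XIII, Prop. 2.8 (iv)] (as quoted in the literature; the primary text is not held by the cell,
acq-09263), whence projectivity — a theorem in print by assembly only, and regularity of the base is load-bearing: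
over a normal non-regular semilocal base Raynaud's example [cite: Raynaud1970, Ch. XIII, 3.2] is a Zariski-locally
trivial torsor of infinite order under an elliptic curve. With a section, `AbelianSectionQuasiProjective[]`: the two
cited theorems above, verbatim up to the tree's typing. After this file the section-free residual is no longer needed
anywhere on row b02's junction.

What is NOT claimed: either residual; any case of `AbelianSchemeVHC`; anything about `HC_AV` or `HC_CM` (row b02 stays
OPEN ≡ `HC_AV` modulo print; «10 · 0» untouched).

References: [Grothendieck1967] EGA IV₄ Cor. 17.16.3 (ii); [SGA1] Exp. XII Prop. 2.4, Prop. 3.1 (iii);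
[CharlesSchnell2014Notes] Conj. 11.3.1, proof of Prop. 11.3.11; [MumfordGIT] §6.1 Def. 6.1, §6.3 Thm. 6.14,
Prop. 6.15; [LaurentSchroer2023] Def. 4.2, Prop. 4.3, Cor. 4.5, Thm. 5.3, and p. 12 (Raynaud XIII 3.2: total spaces
of families of para-abelian varieties need not be schemes); [GortzWedhorn2023] Thm. 27.291 and the remark after its
proof; [Raynaud1970] Ch. XI, Ch. XIII 2.8 (iv), 3.2.
-/

-- every declaration of this problem lives in `Summit.HodgeConjecture.HodgeConjecture.…` (summit = sub-problem);
-- namespace `…Ring2.Binders` = the binder seats of the cell's Hodge-ladder stage 3 (`BINDER-OWNERS.md`)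
set_option linter.dupNamespace false

noncomputable section

open CategoryTheory CategoryTheory.Limits AlgebraicGeometry Topology
open Literature.AlgebraicGeometry Literature.AlgebraicGeometry.Motives
open Literature.AlgebraicGeometry.HodgeTheory

namespace Summit.HodgeConjecture.HodgeConjecture.Ring2.Binders

open Summit.HodgeConjecture.HodgeConjecture.Ring2.Hypotheses

/-- `AbelianSchemeVHCSectionAffine[]` — row b02 `Ring2.Hypotheses.AbelianSchemeVHC` restricted to smooth irreducible
AFFINE bases AND to families admitting a SECTION `e : S ⟶ 𝒳` (`e ≫ f = 𝟙 S`), i.e. to abelian schemes over smooth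
irreducible affine bases (symbol for symbol the body of `AbelianSchemeVHC` plus the two clauses). Local notation only
(no definition is introduced). -/
local notation3 (prettyPrint := false) "AbelianSchemeVHCSectionAffine[]" =>
  ∀ ⦃n : ℕ⦄ ⦃𝒳 S : SchemeOver ℂ⦄ (f : 𝒳 ⟶ S), IsSmoothProjectiveFamily f n → IrreducibleSpace S.left →
    IsAffine S.left → AlgebraicGeometry.Smooth S.hom →
    (∀ s : ComplexPoints S, ∃ A' : AbelianVariety ℂ, A'.dim = n ∧ Nonempty (A'.X ≅ fiberOver f s)) →
    (∃ e : S ⟶ 𝒳, e ≫ f = 𝟙 S) →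
    ∀ (p : ℕ) (W : complexBetti 𝒳 (2 * p)),
      (∀ s : ComplexPoints S, IsRationalClass (complexBetti.map (fiberι f s) (2 * p) W) ∧
        IsOfHodgeType n (fiberOver f s) (2 * p) p p (complexBetti.map (fiberι f s) (2 * p) W)) →
      (∃ s₀ : ComplexPoints S,
        complexBetti.map (fiberι f s₀) (2 * p) W ∈ algebraicClasses (fiberOver f s₀) p) →
      ∀ s : ComplexPoints S, complexBetti.map (fiberι f s) (2 * p) W ∈ algebraicClasses (fiberOver f s) p

/-- `AbelianSchemeVHCGermAffine[]` — verbatim the germ form of row b02 of the junction file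
`Ring2BindersAbelianSchemeVHCLocal.lean` (abelian-fibred smooth projective families with QUASI-PROJECTIVE total space
over smooth irreducible AFFINE bases; one algebraic fibre forces a non-empty Euclidean-open set of algebraic fibres).
A HYPOTHESIS below, never asserted. Local notation only. -/
local notation3 (prettyPrint := false) "AbelianSchemeVHCGermAffine[]" =>
  ∀ ⦃n : ℕ⦄ ⦃𝒳 S : SchemeOver ℂ⦄ (f : 𝒳 ⟶ S), IsSmoothProjectiveFamily f n → IsQuasiProjectiveOver 𝒳 →
    IrreducibleSpace S.left → IsAffine S.left → AlgebraicGeometry.Smooth S.hom →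
    (∀ s : ComplexPoints S, ∃ A' : AbelianVariety ℂ, A'.dim = n ∧ Nonempty (A'.X ≅ fiberOver f s)) →
    ∀ (p : ℕ) (W : complexBetti 𝒳 (2 * p)),
      (∀ s : ComplexPoints S, IsRationalClass (complexBetti.map (fiberι f s) (2 * p) W) ∧
        IsOfHodgeType n (fiberOver f s) (2 * p) p p (complexBetti.map (fiberι f s) (2 * p) W)) →
      ∀ s₀ : ComplexPoints S,
        complexBetti.map (fiberι f s₀) (2 * p) W ∈ algebraicClasses (fiberOver f s₀) p →
        ∃ U : Set (ComplexPoints S), IsOpen U ∧ s₀ ∈ U ∧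
          ∀ s ∈ U, complexBetti.map (fiberι f s) (2 * p) W ∈ algebraicClasses (fiberOver f s) p

/-- `AbelianTotalQuasiProjective[]` — verbatim the SECTION-FREE residual of the junction file
`Ring2BindersAbelianSchemeVHCLocal.lean`: the total space of a smooth proper family with abelian-variety complex fibres
over a smooth irreducible affine `ℂ`-scheme is quasi-projective over `ℂ`. Print: torsor under an abelian scheme
[cite: LaurentSchroer2023, Thm. 5.3] + finite order over a regular base [cite: Raynaud1970, Ch. XIII, Prop. 2.8 (iv)]
+ [cite: GortzWedhorn2023, Thm. 27.291] — by assembly only; false over normal NON-regular semilocal bases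
[cite: Raynaud1970, Ch. XIII, 3.2]. A HYPOTHESIS below, never asserted. Local notation only. -/
local notation3 (prettyPrint := false) "AbelianTotalQuasiProjective[]" =>
  ∀ ⦃n : ℕ⦄ ⦃𝒳 S : SchemeOver ℂ⦄ (f : 𝒳 ⟶ S), IsSmoothProjectiveFamily f n → IrreducibleSpace S.left →
    IsAffine S.left → AlgebraicGeometry.Smooth S.hom →
    (∀ s : ComplexPoints S, ∃ A' : AbelianVariety ℂ, A'.dim = n ∧ Nonempty (A'.X ≅ fiberOver f s)) →
    IsQuasiProjectiveOver 𝒳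

/-- `AbelianSectionQuasiProjective[]` — THE RESIDUAL of this file, the section-free one WEAKENED by the clause "the
family admits a section": the total space of a smooth proper family `f : 𝒳 ⟶ S` with abelian-variety complex fibres
AND A SECTION `e ≫ f = 𝟙 S`, over a smooth irreducible affine `ℂ`-scheme, is quasi-projective over `ℂ`. In print: the
section makes `f` an abelian scheme [cite: LaurentSchroer2023, Prop. 4.3] ([cite: MumfordGIT, Thm. 6.14] for
projective `f`); an abelian scheme over a normal noetherian base is projective over it
[cite: GortzWedhorn2023, Thm. 27.291] (after [cite: Raynaud1970, Ch. XI]); projective over an affine `ℂ`-scheme of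
finite type is quasi-projective over `ℂ`. Not proved in the tree (no relative Picard functor / theorem of the cube
over a base); a HYPOTHESIS below, never asserted. Local notation only. -/
local notation3 (prettyPrint := false) "AbelianSectionQuasiProjective[]" =>
  ∀ ⦃n : ℕ⦄ ⦃𝒳 S : SchemeOver ℂ⦄ (f : 𝒳 ⟶ S), IsSmoothProjectiveFamily f n → IrreducibleSpace S.left →
    IsAffine S.left → AlgebraicGeometry.Smooth S.hom →
    (∀ s : ComplexPoints S, ∃ A' : AbelianVariety ℂ, A'.dim = n ∧ Nonempty (A'.X ≅ fiberOver f s)) →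
    (∃ e : S ⟶ 𝒳, e ≫ f = 𝟙 S) → IsQuasiProjectiveOver 𝒳

/-! ## §0 Propagation along étale neighbourhoods of the base -/

/-- The underlying point of a complex point is the image of ANY point of the one-point scheme `Spec ℂ`. [folklore] -/
theorem pt_eq_base_of_complexPoint {C : SchemeOver ℂ} (t : ComplexPoints C) (x : ↥(Spec (CommRingCat.of ℂ))) :
    t.pt = t.left x := by
  have hx : x = (IsLocalRing.closedPoint ℂ : ↥(Spec (CommRingCat.of ℂ))) := Subsingleton.elim _ _
  subst hx
  rfl

/-- **Propagation along étale neighbourhoods.** On an irreducible `ℂ`-scheme `S` locally of finite type, let `P` be a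
property of complex points such that every `t ∈ S(ℂ)` lies in the image of an ÉTALE `g : U ⟶ S` along which `P` is
constant (`P (g a) → P (g b)` for all `a, b ∈ U(ℂ)`). Then `P` passes from any `s₀` to any `s`: the image of `g(ℂ)` is
open in the analytic topology (`FundamentalGroup.isOpenMap_map_of_etale`, SGA 1 XII 3.1 (iii)), so `{t | P t}` is open
and closed, and `S(ℂ)` is connected (`connectedSpace_complexPoints_of_irreducibleSpace`, SGA 1 XII 2.4).
[cite: SGA1, Exp. XII Prop. 2.4 and Prop. 3.1 (iii)] -/
theorem forall_complexPoints_of_etaleNhds {S : SchemeOver ℂ} [IrreducibleSpace S.left]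
    [LocallyOfFiniteType S.hom] (P : ComplexPoints S → Prop)
    (step : ∀ t : ComplexPoints S, ∃ (U : SchemeOver ℂ) (g : U ⟶ S), Etale g.left ∧
      t ∈ Set.range (AlgPoints.map (L := ℂ) g) ∧
      ∀ a b : ComplexPoints U, P (AlgPoints.map g a) → P (AlgPoints.map g b))
    {s₀ : ComplexPoints S} (h₀ : P s₀) (s : ComplexPoints S) : P s := by
  haveI : ConnectedSpace (ComplexPoints S) := connectedSpace_complexPoints_of_irreducibleSpace S
  have hopen : IsOpen {t : ComplexPoints S | P t} := by
    rw [isOpen_iff_mem_nhds]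
    intro t ht
    obtain ⟨U, g, hg, ⟨a, rfl⟩, hstep⟩ := step t
    haveI := hg
    refine Filter.mem_of_superset
      ((FundamentalGroup.isOpenMap_map_of_etale g).isOpen_range.mem_nhds ⟨a, rfl⟩) ?_
    rintro _ ⟨b, rfl⟩
    exact hstep a b ht
  have hclosed : IsClosed {t : ComplexPoints S | P t} := by
    rw [← isOpen_compl_iff, isOpen_iff_mem_nhds]
    intro t ht
    obtain ⟨U, g, hg, ⟨a, rfl⟩, hstep⟩ := step (t := t)
    haveI := hg
    refine Filter.mem_of_superset
      ((FundamentalGroup.isOpenMap_map_of_etale g).isOpen_range.mem_nhds ⟨a, rfl⟩) ?_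
    rintro _ ⟨b, rfl⟩ hb
    exact ht (hstep b a hb)
  have huniv : {t : ComplexPoints S | P t} = Set.univ := IsClopen.eq_univ ⟨hclosed, hopen⟩ ⟨s₀, h₀⟩
  exact (Set.eq_univ_iff_forall.mp huniv) s

/-! ## §1 Étale neighbourhoods of the base over which a smooth projective family acquires a section -/

/-- **An étale neighbourhood with a section.** Let `f : 𝒳 ⟶ S` be a smooth projective family over a `ℂ`-scheme `S`
with smooth structure map and `t ∈ S(ℂ)`. There are a smooth irreducible AFFINE `ℂ`-scheme `U`, an ÉTALE `g : U ⟶ S`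
whose image on complex points contains `t`, and a SECTION `e` of the base-changed family `𝒳 ×_S U ⟶ U`. Proof: the
fibre `𝒳_t` is non-empty (geometrically irreducible), so the closed set `f⁻¹(pt t)` contains a closed point `x`
(`𝒳` is Jacobson); EGA IV₄ 17.16.3 (`Resolution.exists_etale_nhd_section`) gives an affine étale `g₀ : U₀ → S`, a lift
`σ : U₀ → 𝒳` of `g₀` and a `ℂ`-point `u₀` of `U₀` with `σ(u₀) = x`; `U₀` is smooth over `ℂ`, so `u₀` has an affine
irreducible open neighbourhood `U` (`Morphisms.exists_opens_isAffine_irreducibleSpace_smooth`); `e = (σ|_U, 𝟙)`.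
[cite: Grothendieck1967, EGA IV₄ Cor. 17.16.3 (ii)] -/
theorem exists_etaleNhd_section {n : ℕ} {𝒳 S : SchemeOver ℂ} (f : 𝒳 ⟶ S) (hf : IsSmoothProjectiveFamily f n)
    [hsm : AlgebraicGeometry.Smooth S.hom] (t : ComplexPoints S) :
    ∃ (U : SchemeOver ℂ) (g : U ⟶ S), Etale g.left ∧ IsAffine U.left ∧ IrreducibleSpace U.left ∧
      AlgebraicGeometry.Smooth U.hom ∧ t ∈ Set.range (AlgPoints.map (L := ℂ) g) ∧
      ∃ e : U ⟶ familyPullback f g, e ≫ familyPullback.snd f g = 𝟙 U := by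
  haveI : AlgebraicGeometry.Smooth f.left := hf.smooth
  haveI : LocallyOfFiniteType 𝒳.hom := by rw [← Over.w f]; infer_instance
  haveI : JacobsonSpace ↥𝒳.left := LocallyOfFiniteType.jacobsonSpace 𝒳.hom
  -- (a) a closed point `x` of `𝒳` over `t`
  haveI := (hf.isSmoothProjective t).geometricallyIrreducible
  haveI : IrreducibleSpace ↥(fiberOver f t).left :=
    GeometricallyIrreducible.irreducibleSpace_of_subsingleton (fiberOver f t).hom
  obtain ⟨z⟩ := (inferInstance : Nonempty ↥(fiberOver f t).left)
  have hz : f.left ((fiberι f t).left z) = t.pt := by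
    have h1 := congrArg (fun φ : fiberOver f t ⟶ S => φ.left z) (fiberι_comp f t)
    simp only [Over.comp_left, Scheme.Hom.comp_apply] at h1
    rw [h1, ← pt_eq_base_of_complexPoint]
  have hF : IsClosed (f.left ⁻¹' {t.pt}) := (AlgPoints.isClosed_singleton_pt t).preimage f.left.continuous
  obtain ⟨x, hxF, hxc⟩ := nonempty_inter_closedPoints (Z := f.left ⁻¹' {t.pt}) ⟨_, hz⟩ hF.isLocallyClosed
  rw [mem_closedPoints_iff] at hxc
  have hx' : f.left x = t.pt := by simpa using hxF
  -- (b) EGA IV 17.16.3: an affine étale neighbourhood of `pt t` with a lift through `x`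
  have hxs : x ∈ f.left.smoothLocus := by
    rw [Scheme.Hom.smoothLocus_eq_top]; exact TopologicalSpace.Opens.mem_top x
  obtain ⟨U₀, hU₀, g, hg, σ, pu, hσ, hpu⟩ :=
    Resolution.exists_etale_nhd_section (k := ℂ) S.hom f.left hxs hxc
  -- (c) shrink the neighbourhood to an affine IRREDUCIBLE open around the point (it is smooth over `ℂ`)
  haveI := hg
  haveI : AlgebraicGeometry.Smooth (g ≫ S.hom) := inferInstance
  obtain ⟨V, hVaff, hyV, hVirr⟩ := Morphisms.exists_isAffineOpen_irreducibleSpace_of_smooth (g ≫ S.hom)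
    (pu.base (IsLocalRing.closedPoint ℂ))
  let U : SchemeOver ℂ := Over.mk (V.ι ≫ g ≫ S.hom)
  let gU : U ⟶ S := Over.homMk (V.ι ≫ g) (Category.assoc _ _ _)
  -- the lifted complex point of `U`, mapping to `t`
  have hrange : Set.range pu.base ⊆ Set.range V.ι.base := by
    rintro _ ⟨y, rfl⟩
    rw [Subsingleton.elim y (IsLocalRing.closedPoint ℂ), Scheme.Opens.range_ι]
    exact hyV
  obtain ⟨ũ, hũ⟩ : ∃ ũ : Spec (CommRingCat.of ℂ) ⟶ (V : Scheme), ũ ≫ V.ι = pu :=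
    ⟨IsOpenImmersion.lift V.ι pu hrange, IsOpenImmersion.lift_fac V.ι pu hrange⟩
  have hpuS : pu ≫ g ≫ S.hom = 𝟙 _ := by
    rw [← hσ, Category.assoc, ← Category.assoc pu σ, hpu, pointOfClosedPoint_comp]
  have hũS : ũ ≫ V.ι ≫ g ≫ S.hom = Spec.map (CommRingCat.ofHom (algebraMap ℂ ℂ)) := by
    rw [← Category.assoc, hũ, hpuS, Algebra.algebraMap_self, CommRingCat.ofHom_id, Spec.map_id]
  let u : ComplexPoints U := AlgPoints.mk ũ hũS
  have hut : AlgPoints.map gU u = t := by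
    haveI : LocallyOfFiniteType S.hom := inferInstance
    have e1 : (AlgPoints.map gU u).left = pointOfClosedPoint (f.left ≫ S.hom) x hxc ≫ f.left := by
      show ũ ≫ V.ι ≫ g = _
      rw [← Category.assoc, hũ, ← hσ, ← Category.assoc, hpu]
    apply Over.OverMorphism.ext
    rw [e1]
    refine ext_of_apply_closedPoint_eq S.hom ?_ (AlgPoints.left_comp_hom_eq_id t) ?_
    · rw [Category.assoc, pointOfClosedPoint_comp]
    · rw [Scheme.Hom.comp_apply, pointOfClosedPoint_apply]
      exact hx'.trans (pt_eq_base_of_complexPoint t _)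
  -- (d) the section of the base-changed family
  have hsec : (V.ι ≫ σ) ≫ f.left = 𝟙 (V : Scheme) ≫ V.ι ≫ g := by
    rw [Category.assoc, hσ, Category.id_comp]
  have hcond : pullback.lift (V.ι ≫ σ) (𝟙 (V : Scheme)) hsec ≫ pullback.fst f.left (V.ι ≫ g) ≫ 𝒳.hom =
      V.ι ≫ g ≫ S.hom := by
    rw [← Category.assoc, pullback.lift_fst, ← Over.w f, Category.assoc V.ι σ (f.left ≫ S.hom),
      ← Category.assoc σ f.left S.hom, hσ]
  have hsnd : pullback.lift (V.ι ≫ σ) (𝟙 (V : Scheme)) hsec ≫ pullback.snd f.left (V.ι ≫ g) = 𝟙 _ :=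
    pullback.lift_snd _ _ _
  let e : U ⟶ familyPullback f gU := Over.homMk (pullback.lift (V.ι ≫ σ) (𝟙 (V : Scheme)) hsec) hcond
  refine ⟨U, gU, inferInstanceAs (Etale (V.ι ≫ g)), hVaff, hVirr,
    inferInstanceAs (AlgebraicGeometry.Smooth (V.ι ≫ g ≫ S.hom)), ⟨u, hut⟩, e, ?_⟩
  ext : 1
  exact hsnd

/-! ## §2 Row b02 is its own restriction to families with a section (abelian schemes) -/

/-- **(S1) Row b02 reduces to abelian schemes — families WITH A SECTION — over smooth irreducible AFFINE bases.**
Given the variational Hodge statement for abelian-fibred smooth projective families admitting a section over smooth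
irreducible affine `ℂ`-schemes, it holds for every abelian-fibred family over every smooth irreducible `ℂ`-scheme:
propagate algebraicity of `W|_{𝒳_t}` along the étale neighbourhoods of `exists_etaleNhd_section`
(`forall_complexPoints_of_etaleNhds`), moving the fibrewise hypotheses, the anchor and the conclusion across the base
change (`Theorems.familyPullback_fibrewise_rational_hodgeType`, `Theorems.map_fiberι_familyPullback_mem_algebraicClasses_iff`,
`abelianFibres_familyPullback`). No separatedness, quasi-compactness or quasi-projectivity of anything is used.
[cite: Grothendieck1966, footnote 13] [cite: CharlesSchnell2014Notes, Conj. 11.3.1]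
[cite: Grothendieck1967, EGA IV₄ Cor. 17.16.3 (ii)] -/
theorem abelianSchemeVHC_of_section (h : AbelianSchemeVHCSectionAffine[]) : AbelianSchemeVHC := by
  intro n 𝒳 S f hf hirr hsm habel p W hW h₀ s
  obtain ⟨s₀, hs₀⟩ := h₀
  haveI := hirr
  haveI := hsm
  haveI : LocallyOfFiniteType S.hom := inferInstance
  refine forall_complexPoints_of_etaleNhds (S := S)
    (fun t => complexBetti.map (fiberι f t) (2 * p) W ∈ algebraicClasses (fiberOver f t) p) ?_ hs₀ s
  intro t
  obtain ⟨U, g, hg, haff, hirrU, hsmU, htU, e, he⟩ := exists_etaleNhd_section f hf t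
  refine ⟨U, g, hg, htU, fun a b ha => ?_⟩
  rw [← Theorems.map_fiberι_familyPullback_mem_algebraicClasses_iff f g hf W b]
  rw [← Theorems.map_fiberι_familyPullback_mem_algebraicClasses_iff f g hf W a] at ha
  have habel' : ∀ s' : ComplexPoints U, ∃ A' : AbelianVariety ℂ, A'.dim = n ∧
      Nonempty (A'.X ≅ fiberOver (familyPullback.snd f g) s') :=
    (abelianFibres_iff_of_isSmoothProjectiveFamily (hf.familyPullback_snd g)).2
      (abelianFibres_familyPullback f g ((abelianFibres_iff_of_isSmoothProjectiveFamily hf).1 habel))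
  exact h (familyPullback.snd f g) (hf.familyPullback_snd g) hirrU haff hsmU habel' ⟨e, he⟩ p
    (complexBetti.map (familyPullback.fst f g) (2 * p) W)
    (Theorems.familyPullback_fibrewise_rational_hodgeType f g W hW) ⟨a, ha⟩ b

/-- Restriction: row b02 gives its affine-base-with-section form (forget the two clauses). [folklore] -/
theorem abelianSchemeVHCSectionAffine_of_abelianSchemeVHC (h : AbelianSchemeVHC) :
    AbelianSchemeVHCSectionAffine[] :=
  fun _ _ _ f hf hirr _ hsm habel _ p W hW h₀ s => h f hf hirr hsm habel p W hW h₀ s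

/-- **(S1′) EXACTNESS: row b02 `AbelianSchemeVHC` (section-free typing) IS the variational Hodge statement for abelian
schemes (families with a section) over smooth irreducible affine bases** — the tree's section-free typing of row b02
costs nothing. [cite: Grothendieck1966, footnote 13] [cite: CharlesSchnell2014Notes, Conj. 11.3.1]
[cite: Deligne1982HodgeCycles, Milne 2003 re-edition endnote 19] -/
theorem abelianSchemeVHC_iff_section : AbelianSchemeVHC ↔ AbelianSchemeVHCSectionAffine[] :=
  ⟨abelianSchemeVHCSectionAffine_of_abelianSchemeVHC, abelianSchemeVHC_of_section⟩

/-! ## §3 The junction's edges with the residual weakened to families with a section -/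

/-- The with-section residual is implied by the section-free one (forget the section). [folklore] -/
theorem abelianSectionQuasiProjective_of_abelianTotalQuasiProjective (h : AbelianTotalQuasiProjective[]) :
    AbelianSectionQuasiProjective[] :=
  fun _ _ _ f hf hirr haff hsm habel _ => h f hf hirr haff hsm habel

/-- **(S2) Row b02 from its GERM form, granted only the with-section residual `AbelianSectionQuasiProjective[]`**:
reduce to families with a section over affine bases (S1); there the total space is quasi-projective by the residual
and the junction's (L2) `abelianSchemeVHC_conclusion_of_germ` (Charles–Schnell countable union of algebraicity loci +
Baire + Mumford's curve lemma, tree theorems) concludes. Supersedes (L2′) of the junction file, whose residual was the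
section-free one. [cite: CharlesSchnell2014Notes, Conj. 11.3.1 and Prop. 11.3.11 (proof)]
[cite: LaurentSchroer2023, Prop. 4.3] [cite: GortzWedhorn2023, Thm. 27.291] -/
theorem abelianSchemeVHC_of_germ_of_abelianSectionQuasiProjective (hqp : AbelianSectionQuasiProjective[])
    (hG : AbelianSchemeVHCGermAffine[]) : AbelianSchemeVHC :=
  abelianSchemeVHC_of_section fun _ _ _ f hf hirr haff hsm habel he p W hW h₀ s => by
    haveI := hirr
    haveI := haff
    haveI := hsm
    exact abelianSchemeVHC_conclusion_of_germ hG f hf (hqp f hf hirr haff hsm habel he) habel p W hW h₀ s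

/-- **(S2′) EXACTNESS modulo the with-section residual: row b02 `AbelianSchemeVHC` ⟺ its germ form on engine-ready
carriers.** Supersedes (L2″) of the junction file. [cite: CharlesSchnell2014Notes, Conj. 11.3.1 and Prop. 11.3.11 (proof)]
[cite: LaurentSchroer2023, Prop. 4.3] [cite: GortzWedhorn2023, Thm. 27.291] -/
theorem abelianSchemeVHC_iff_germ_of_abelianSectionQuasiProjective (hqp : AbelianSectionQuasiProjective[]) :
    AbelianSchemeVHC ↔ AbelianSchemeVHCGermAffine[] :=
  ⟨abelianSchemeVHCGermAffine_of_abelianSchemeVHC, abelianSchemeVHC_of_germ_of_abelianSectionQuasiProjective hqp⟩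

/-- **(S3) `VariationalHodgeQP ⟹ AbelianSchemeVHC` granted only the with-section residual.** Reduce to families with
a section over affine bases (S1); there the total space is quasi-projective by the residual, so seat b03's junction
(J1) `Binders.variationalHodge_quasiProjective_of_variationalHodgeQP` (part XXVII's printed-carrier node,
Charles–Schnell Conj. 11.3.1 on quasi-projective total spaces) concludes. Supersedes (L3) of the junction file.
[cite: CharlesSchnell2014Notes, Conj. 11.3.1] [cite: LaurentSchroer2023, Prop. 4.3] [cite: GortzWedhorn2023, Thm. 27.291] -/
theorem abelianSchemeVHC_of_variationalHodgeQP_of_abelianSectionQuasiProjective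
    (hqp : AbelianSectionQuasiProjective[]) (hV : VariationalHodgeQP) : AbelianSchemeVHC :=
  abelianSchemeVHC_of_section fun _ _ _ f hf hirr haff hsm habel he p W hW h₀ s =>
    variationalHodge_quasiProjective_of_variationalHodgeQP hV f hf (hqp f hf hirr haff hsm habel he) hirr hsm p W
      hW h₀ s

/-- (S3, flat-section form) Charles–Schnell's Conj. 11.3.1 on its printed carriers (`FlatSectionsAlgebraicQP`, part
XXVII) reaches row b02 granted only the with-section residual. Supersedes the flat-section form of (L3).
[cite: CharlesSchnell2014Notes, Conj. 11.3.1, Thm. 11.3.4 and proof of Prop. 11.3.5] -/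
theorem abelianSchemeVHC_of_flatSectionsAlgebraicQP_of_abelianSectionQuasiProjective
    (hqp : AbelianSectionQuasiProjective[]) (hF : FlatSectionsAlgebraicQP) : AbelianSchemeVHC :=
  abelianSchemeVHC_of_variationalHodgeQP_of_abelianSectionQuasiProjective hqp
    (variationalHodgeQP_of_flatSectionsAlgebraicQP hF)

/-! ## Audit

`#print axioms` of every theorem above: `propext`, `Classical.choice`, `Quot.sound` (checked at submission). No
`sorry`, no new `def`/`axiom`/`opaque`, no Literature named fact as hypothesis; the only displayed inline Props are the
germ form of row b02 itself, the printed-carrier nodes `VariationalHodgeQP` / `FlatSectionsAlgebraicQP` of part XXVII,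
and the two residuals `AbelianTotalQuasiProjective[]` ⟹ `AbelianSectionQuasiProjective[]`, never asserted.
-/

end Summit.HodgeConjecture.HodgeConjecture.Ring2.Binders

end
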